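import Mathlib.Algebra.BigOperators.Fin
import Mathlib.Algebra.Order.BigOperators.Group.Finset
import Mathlib.Data.Finset.Max
import Literature.Geometry.DiscreteGeometry.PolyCert

/-!
# Kronecker substitution for sparse trivariate term lists

Framing: lottery ticket; floor = certified bounds/negative ranges. Venture `PackingBounds`
(cell `pub-packcert`), three-point SDP family — kernel-checking infrastructure.

The term lists `SPoly` of `Literature/…/PolyCert` (sparse integer polynomials in `u, v, t`) are
identified by ONE integer: the value at the point `(2^w, 2^{wD}, 2^{wD²})` (Kronecker substitution;
the monomial `u^a v^b t^c` with `a, b, c < D` lands in the binary digit block ("slot")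
`a + D b + D² c`, width `w`). `eval_eq_zero_of_kronecker`: if every exponent is `< D`, twice the
absolute coefficient sum is `< 2^w` and the integer value vanishes, then the term list is the zero
function on `ℝ³` (balanced-digit uniqueness, `digits_eq_zero`). This lets the kernel validate a
claimed polynomial identity — in `ThreePointCert.CheckKS`, a sums-of-squares Gram expansion
`E = Σ_k (Σ_i L_{ik} z_i)²` — with a few hundred big-integer operations done by the kernel's GMP
arithmetic instead of a term-by-term expansion (`ThreePointCert.CheckKron`: one packed dot product
and one sorted merge per PAIR of basis monomials). Also: the integer evaluation `evalZ` with its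
cast lemma to `SPoly.eval` and the resulting ring-homomorphism properties.

No statement about certificates is made here.
-/

noncomputable section

open Finset

namespace Summit.Ventures.PackingBounds.ThreePointCert

open Literature.Geometry.DiscreteGeometry Literature.Geometry.DiscreteGeometry.PolyCert
open Literature.Geometry.DiscreteGeometry.PolyCert.SPoly

/-! ### Integer evaluation -/

/-- Integer value of the monomial `u^a v^b t^c` at an integer point. -/
def monoEvalZ (m : Mono) (x y z : ℤ) : ℤ := x ^ m.a * y ^ m.b * z ^ m.c

/-- Integer value of a term list at an integer point. -/
def evalZ (p : SPoly) (x y z : ℤ) : ℤ := (p.map fun mc => mc.2 * monoEvalZ mc.1 x y z).sum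

/-- `evalZ []`. -/
@[simp] theorem evalZ_nil (x y z : ℤ) : evalZ [] x y z = 0 := by simp [evalZ]

/-- `evalZ` of a cons. -/
@[simp] theorem evalZ_cons (mc : Mono × ℤ) (p : SPoly) (x y z : ℤ) :
    evalZ (mc :: p) x y z = mc.2 * monoEvalZ mc.1 x y z + evalZ p x y z := by
  simp [evalZ]

/-- `evalZ` is additive over concatenation. -/
@[simp] theorem evalZ_append (p q : SPoly) (x y z : ℤ) :
    evalZ (p ++ q) x y z = evalZ p x y z + evalZ q x y z := by
  simp [evalZ, List.sum_append]

/-- The integer monomial value casts to the real one. -/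
theorem cast_monoEvalZ (m : Mono) (x y z : ℤ) :
    ((monoEvalZ m x y z : ℤ) : ℝ) = m.eval (x : ℝ) (y : ℝ) (z : ℝ) := by
  simp [monoEvalZ, Mono.eval]

/-- The integer value casts to the real value. -/
theorem cast_evalZ (p : SPoly) (x y z : ℤ) :
    ((evalZ p x y z : ℤ) : ℝ) = eval p (x : ℝ) (y : ℝ) (z : ℝ) := by
  induction p with
  | nil => simp
  | cons mc p ih => rw [evalZ_cons, eval_cons]; push_cast; rw [ih, cast_monoEvalZ]

/-- `evalZ` is multiplicative (transferred from `eval_mul` through the cast). -/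
theorem evalZ_mul (p q : SPoly) (x y z : ℤ) :
    evalZ (mul p q) x y z = evalZ p x y z * evalZ q x y z := by
  have h : ((evalZ (mul p q) x y z : ℤ) : ℝ) = ((evalZ p x y z * evalZ q x y z : ℤ) : ℝ) := by
    push_cast; rw [cast_evalZ, cast_evalZ, cast_evalZ, eval_mul]
  exact_mod_cast h

/-- `evalZ` of a scalar multiple. -/
theorem evalZ_smul (c : ℤ) (p : SPoly) (x y z : ℤ) : evalZ (smul c p) x y z = c * evalZ p x y z := by
  have h : ((evalZ (smul c p) x y z : ℤ) : ℝ) = ((c * evalZ p x y z : ℤ) : ℝ) := by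
    push_cast; rw [cast_evalZ, cast_evalZ, eval_smul]
  exact_mod_cast h

/-- `evalZ` of a negation. -/
theorem evalZ_neg (p : SPoly) (x y z : ℤ) : evalZ (neg p) x y z = -evalZ p x y z := by
  rw [neg, evalZ_smul]; ring

/-! ### Slots -/

/-- Digit block ("slot") of a monomial in base `D`. -/
def slot (D : ℕ) (m : Mono) : ℕ := m.a + D * (m.b + D * m.c)

/-- The monomial of a slot. -/
def ofSlot (D s : ℕ) : Mono := ⟨s % D, s / D % D, s / D / D⟩

/-- `ofSlot` inverts `slot` on the box. -/
theorem ofSlot_slot (D : ℕ) (m : Mono) (h : m.a < D ∧ m.b < D ∧ m.c < D) : ofSlot D (slot D m) = m := by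
  obtain ⟨ha, hb, _⟩ := h
  have hD : 0 < D := by omega
  have h1 : (m.a + D * (m.b + D * m.c)) % D = m.a := by
    rw [Nat.add_mul_mod_self_left, Nat.mod_eq_of_lt ha]
  have h2 : (m.a + D * (m.b + D * m.c)) / D = m.b + D * m.c := by
    rw [Nat.add_mul_div_left _ _ hD, Nat.div_eq_of_lt ha, zero_add]
  have h3 : (m.b + D * m.c) % D = m.b := by rw [Nat.add_mul_mod_self_left, Nat.mod_eq_of_lt hb]
  have h4 : (m.b + D * m.c) / D = m.c := by rw [Nat.add_mul_div_left _ _ hD, Nat.div_eq_of_lt hb, zero_add]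
  cases m
  simp only [ofSlot, slot] at *
  rw [h1, h2, h3, h4]

/-- At the Kronecker point a monomial is the power of two of its slot position. -/
theorem monoEvalZ_kronecker (w D : ℕ) (m : Mono) :
    monoEvalZ m (2 ^ w) (2 ^ (w * D)) (2 ^ (w * D * D)) = 2 ^ (w * slot D m) := by
  simp only [monoEvalZ, slot, ← pow_mul, ← pow_add]
  congr 1; ring

/-! ### List sums as `Fin`-indexed sums -/

/-- A mapped list sum as a sum over indices. -/
theorem sum_map_eq_sum_fin {α M : Type*} [AddCommMonoid M] (f : α → M) :
    ∀ l : List α, (l.map f).sum = ∑ i : Fin l.length, f l[(i : ℕ)]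
  | [] => by simp
  | a :: l => by
    rw [List.map_cons, List.sum_cons, sum_map_eq_sum_fin f l]
    show f a + _ = ∑ i : Fin (l.length + 1), f (a :: l)[(i : ℕ)]
    rw [Fin.sum_univ_succ]
    simp only [Fin.val_zero, List.getElem_cons_zero, Fin.val_succ, List.getElem_cons_succ]

/-- Fibrewise regrouping of `∑ i, c i * F (s i)` along the values of `s`. -/
theorem sum_mul_apply_eq_sum_fiber {ι R : Type*} [Fintype ι] [CommRing R] (s : ι → ℕ) (c : ι → R)
    (F : ℕ → R) :
    ∑ i, c i * F (s i) =
      ∑ j ∈ univ.image s, (∑ i ∈ univ.filter (fun i => s i = j), c i) * F j := by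
  rw [← sum_fiberwise_of_maps_to (s := univ) (t := univ.image s) (g := s)
    (fun i hi => mem_image_of_mem s hi)]
  refine sum_congr rfl fun j _ => ?_
  rw [sum_mul]
  refine sum_congr rfl fun i hi => ?_
  rw [(mem_filter.1 hi).2]

/-! ### Balanced digits -/

/-- **Balanced-digit uniqueness.** If `Σ_{j ∈ T} C_j 2^{wj} = 0` with all `|C_j| ≤ K` and
`2K < 2^w`, then every `C_j` (`j ∈ T`) vanishes. -/
theorem digits_eq_zero (w K : ℕ) (hK : 2 * K < 2 ^ w) (C : ℕ → ℤ) (hC : ∀ j, |C j| ≤ K)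
    (T : Finset ℕ) : ∑ j ∈ T, C j * 2 ^ (w * j) = 0 → ∀ j ∈ T, C j = 0 := by
  induction T using Finset.induction_on_min with
  | empty => simp
  | insert a T haT ih =>
    intro hsum j hj
    have ha : a ∉ T := fun h => lt_irrefl a (haT a h)
    rw [sum_insert ha] at hsum
    set M := ∑ j ∈ T, C j * 2 ^ (w * (j - (a + 1))) with hM
    have hT : ∑ j ∈ T, C j * 2 ^ (w * j) = 2 ^ (w * (a + 1)) * M := by
      rw [hM, mul_sum]
      refine sum_congr rfl fun j hj => ?_
      have hlt : a < j := haT j hj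
      rw [mul_left_comm, ← pow_add, ← Nat.mul_add]
      congr 3; omega
    rw [hT, show w * (a + 1) = w * a + w by ring, pow_add] at hsum
    have h2 : C a + 2 ^ w * M = 0 := by
      have hpow : (2 : ℤ) ^ (w * a) ≠ 0 := pow_ne_zero _ two_ne_zero
      have : (2 : ℤ) ^ (w * a) * (C a + 2 ^ w * M) = 0 := by rw [← hsum]; ring
      exact (mul_eq_zero.1 this).resolve_left hpow
    have hMa : M = 0 := by
      by_contra hne
      have h1 : (2 : ℤ) ^ w ≤ |C a| := by
        have e : C a = -(2 ^ w * M) := by linarith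
        rw [e, abs_neg, abs_mul, abs_of_pos (by positivity : (0 : ℤ) < 2 ^ w)]
        exact le_mul_of_one_le_right (by positivity) (Int.one_le_abs hne)
      have h3 : |C a| ≤ K := hC a
      have h4 : (2 : ℤ) * K < 2 ^ w := by exact_mod_cast hK
      have h5 : (0 : ℤ) ≤ K := by positivity
      linarith
    have hCa : C a = 0 := by rw [hMa, mul_zero, add_zero] at h2; exact h2
    rcases mem_insert.1 hj with rfl | hj'
    · exact hCa
    · exact ih (by rw [hT, hMa, mul_zero]) j hj'

/-! ### The injectivity theorem -/

/-- **Kronecker substitution is injective on bounded term lists.** A term list with exponents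
`< D`, twice its absolute coefficient sum `< 2^w`, and integer value `0` at `(2^w, 2^{wD}, 2^{wD²})`
is the zero function. -/
theorem eval_eq_zero_of_kronecker (w D : ℕ) (p : SPoly)
    (hbox : ∀ mc ∈ p, mc.1.a < D ∧ mc.1.b < D ∧ mc.1.c < D)
    (habs : 2 * absSum p < 2 ^ w) (h0 : evalZ p (2 ^ w) (2 ^ (w * D)) (2 ^ (w * D * D)) = 0)
    (u v t : ℝ) : eval p u v t = 0 := by
  -- indexed data
  let c : Fin p.length → ℤ := fun i => (p[(i : ℕ)]).2
  let s : Fin p.length → ℕ := fun i => slot D (p[(i : ℕ)]).1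
  have hmem : ∀ i : Fin p.length, p[(i : ℕ)] ∈ p := fun i => List.getElem_mem _
  -- (1) the integer value as a digit sum
  have h1 : ∑ i, c i * (2 : ℤ) ^ (w * s i) = 0 := by
    rw [← h0]; unfold evalZ; rw [sum_map_eq_sum_fin]
    exact sum_congr rfl fun i _ => by rw [monoEvalZ_kronecker]
  -- (2) regroup along slots
  let C : ℕ → ℤ := fun j => ∑ i ∈ univ.filter (fun i => s i = j), c i
  have h2 : ∑ j ∈ univ.image s, C j * (2 : ℤ) ^ (w * j) = 0 := by
    rw [← h1, sum_mul_apply_eq_sum_fiber s c (fun j => (2 : ℤ) ^ (w * j))]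
  -- (3) coefficient bound
  have habsZ : ((absSum p : ℕ) : ℤ) = ∑ i, |c i| := by
    unfold absSum; rw [sum_map_eq_sum_fin, Nat.cast_sum]
    exact sum_congr rfl fun i _ => Int.natCast_natAbs _
  have hC : ∀ j, |C j| ≤ (absSum p : ℤ) := by
    intro j
    calc |C j| ≤ ∑ i ∈ univ.filter (fun i => s i = j), |c i| := abs_sum_le_sum_abs _ _
      _ ≤ ∑ i, |c i| :=
          sum_le_sum_of_subset_of_nonneg (filter_subset _ _) fun i _ _ => abs_nonneg _
      _ = (absSum p : ℤ) := habsZ.symm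
  have hzero : ∀ j ∈ univ.image s, C j = 0 := digits_eq_zero w (absSum p) habs C hC _ h2
  -- (4) the real value regrouped the same way
  have h4 : eval p u v t = ∑ i, (c i : ℝ) * (ofSlot D (s i)).eval u v t := by
    unfold eval; rw [sum_map_eq_sum_fin]
    exact sum_congr rfl fun i _ => by rw [ofSlot_slot D _ (hbox _ (hmem i))]
  rw [h4, sum_mul_apply_eq_sum_fiber s (fun i => (c i : ℝ)) (fun j => (ofSlot D j).eval u v t)]
  refine sum_eq_zero fun j hj => ?_
  have : ((C j : ℤ) : ℝ) = ∑ i ∈ univ.filter (fun i => s i = j), (c i : ℝ) := Int.cast_sum _ _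
  rw [← this, hzero j hj]; simp

end Summit.Ventures.PackingBounds.ThreePointCert

end
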